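import Summits.NavierStokesRegularity.NavierStokesRegularity.Theorems.TypeIQuantSubcubicExp.Negative.QuietCoreEnvelopeLoud
import Literature.Analysis.FluidPDE.TypeIAncientMildRescale
import HarnessLib

/-!
# Level-`c(M)` uniform loudness at every scale, and CLOSEDNESS OF THE APEX SINGULARITY in the envelope class —
# refuter side, negative lane, BY NAME

Crux `stmt-NavierStokesRegularity-24077` (`QuarterLogPincer.TypeIQuantSubcubicExp`). Sequel to
`Negative/QuietCoreEnvelopeLoud.lean` (p692638). By name from the tree's `subcriticalUpgrade_all` (S3♭, p690761) and
`budgetPass` (S4♭, p688377) SEPARATELY (instead of the packaged `quietCore_all`), the floor LEVEL becomes `c(M)` —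
independent of the budget — and only the ONSET depends on the budget; with the Literature scalings
`IsTypeIAncientMild.nsRescale`, `HasTypeIDecay.nsRescale` (same constants) the floor holds at EVERY scale `λ ∈ (0,1]`
inside `B(0,λ)` from the onset `λ² s₀(M,A)` on, uniformly over the class; hence the apex singularity is CLOSED under
locally uniform limits at fixed `(M, A)`.

* (U1) `exists_levelM_loud_of_cubeBudget M : ∃ c(M) > 0, ∀ B, ∃ s₀(M,B) < 0, ∀ v`, Type-I(M) + `CubeBudgetWith B v` +
  `SingularAt v 0` ⇒ loud on `B(0,1)` at level `c/√(−s)` for all `s ∈ [s₀,0)` — the UNIFORM-ONSET typing of the line's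
  workfile §7 `uniformFloor_logCube` (quiet_core v1.8 types `∃ s₀` after `v`; its proof, as here, chooses `s₀` before).
* (U2) `exists_levelM_loud_of_envelope`: the same on the envelope class `HasTypeIDecay A` (`B = 3·|B₁|·A³`).
* (U3) `singularAt_zero_nsRescale_of_singularAt`: the apex singularity is invariant under the zoom `v ↦ λv(λ²·,λ·)`.
* (U4) `exists_levelM_multiscale_loud_of_envelope`: level `c(M)`, onset `λ² s₀(M,A)`, loud point in `B(0,λ)`, for
  EVERY `λ ∈ (0,1]`, uniformly over the class.
* (U5) `singularAt_zero_of_limit_envelopedSingular`: if `v_n` are enveloped singular members with the same `(M, A)` and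
  `v_n(s,·) → w(s,·)` uniformly on `B(0,1)` at each fixed `s < 0`, then `SingularAt w 0` — the limit is singular AT THE
  APEX (no re-centring, no ε-regularity).

Reading (cubic_rung C2 `stub_budgetCompactness`, audit v5 of this seat): (U5) is gap C2(b) («stability of the singular
point under the `q_n ↓ 0` limit») CLOSED in the envelope sub-class by name; the thin (energy) class needs the same two
inputs — a uniform-onset floor (workfile §7 re-typed) and a uniform energy bound along the sequence (gap C2(a)).
Instrument reading: the apex singularity of the hypothetical Type-I (R)DSS candidate family is closed under limits at
fixed `(M, A)`. Honest label: theorems about HYPOTHETICAL objects — under item stmt-4050 the class is `{0}` and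
(U1)–(U5) are vacuous; nothing here asserts or refutes 24077, 24453, 22144 or 4050; no summit statement is proved by
this file. [folklore]
-/

-- the summit and its single sub-problem share the name (CONVENTIONS §1), as in every Theorems file
set_option linter.dupNamespace false

namespace Summit.NavierStokesRegularity.NavierStokesRegularity.Theorems.TypeIQuantSubcubicExp.Negative

open MeasureTheory Set Metric Function
open Literature.Analysis Literature.Analysis.FluidPDE
open Summit.NavierStokesRegularity.NavierStokesRegularity.Cruxes.TypeIQuantSubcubicExp
open Summit.NavierStokesRegularity.NavierStokesRegularity.Cruxes.TypeIQuantSubcubicExp.ThinCascade (SingularAt)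
open Summit.NavierStokesRegularity.NavierStokesRegularity.Cruxes.TypeIQuantSubcubicExp.TruncationEdge
open Summit.NavierStokesRegularity.NavierStokesRegularity.Cruxes.TypeIQuantSubcubicExp.QuietCore
open scoped ENNReal NNReal

/-! ### (U1)/(U2) level `c(M)`, onset before the field -/

/-- **(U1) UNIFORM-ONSET, LEVEL-`c(M)` LOUDNESS, log-cube class**: S3♭ and S4♭ by name, separately — the quiet
level `c₀(M)` of `subcriticalUpgrade_all` is budget-free, the budget enters only the onset through `budgetPass`.
[folklore] -/
theorem exists_levelM_loud_of_cubeBudget (M : ℝ) :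
    ∃ c : ℝ, 0 < c ∧ ∀ B : ℝ, ∃ s₀ : ℝ, s₀ < 0 ∧
      ∀ v : ℝ → EuclideanSpace ℝ (Fin 3) → EuclideanSpace ℝ (Fin 3),
        IsTypeIAncientMild M v → CubeBudgetWith B v → SingularAt v 0 →
        ∀ s ∈ Set.Ico s₀ 0, ∃ x ∈ Metric.ball (0 : EuclideanSpace ℝ (Fin 3)) 1,
          c / Real.sqrt (-s) < ‖v s x‖ := by
  obtain ⟨c₀, s₁, hc₀, hs₁, hup⟩ := subcriticalUpgrade_all M
  refine ⟨c₀, hc₀, fun B => ?_⟩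
  obtain ⟨s₂, K, hs₂, -, hpass⟩ := budgetPass M B c₀ hc₀
  refine ⟨max s₁ s₂, max_lt hs₁ hs₂, fun v hv hB hsing s hs => ?_⟩
  have hs1 : s ∈ Set.Ico s₁ 0 := ⟨(le_max_left _ _).trans hs.1, hs.2⟩
  have hs2 : s ∈ Set.Ico s₂ 0 := ⟨(le_max_right _ _).trans hs.1, hs.2⟩
  by_contra hq
  push Not at hq
  exact not_singularAt_zero_of_bound hs.2
    (hpass v hv hB s hs2 (hup v hv s hs1 fun x hx => hq x hx)) hsing

/-- **(U2) the same on the ENVELOPE class** (`HasTypeIDecay A v`; budget `3·|B₁|·A³` by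
`cubeBudgetWith_of_hasTypeIDecay`; `A < 0` is absurd). [folklore] -/
theorem exists_levelM_loud_of_envelope (M : ℝ) :
    ∃ c : ℝ, 0 < c ∧ ∀ A : ℝ, ∃ s₀ : ℝ, s₀ < 0 ∧
      ∀ v : ℝ → EuclideanSpace ℝ (Fin 3) → EuclideanSpace ℝ (Fin 3),
        IsTypeIAncientMild M v → HasTypeIDecay A v → SingularAt v 0 →
        ∀ s ∈ Set.Ico s₀ 0, ∃ x ∈ Metric.ball (0 : EuclideanSpace ℝ (Fin 3)) 1,
          c / Real.sqrt (-s) < ‖v s x‖ := by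
  obtain ⟨c, hc, H⟩ := exists_levelM_loud_of_cubeBudget M
  refine ⟨c, hc, fun A => ?_⟩
  by_cases hA : 0 ≤ A
  · obtain ⟨s₀, hs₀, H'⟩ :=
      H (3 * (volume : Measure (EuclideanSpace ℝ (Fin 3))).real (ball 0 1) * A ^ 3)
    exact ⟨s₀, hs₀, fun v hv hdec => H' v hv (cubeBudgetWith_of_hasTypeIDecay hA hdec)⟩
  · refine ⟨-1, by norm_num, fun v _ hdec => absurd ?_ hA⟩
    have h := hdec (-1) (by norm_num) 0
    simp only [norm_zero, neg_neg, Real.sqrt_one, zero_add, div_one] at h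
    exact (norm_nonneg _).trans h

/-! ### (U3) the apex singularity is scale-invariant -/

/-- **(U3)** `SingularAt v 0 → SingularAt (λv(λ²·,λ·)) 0` for `λ > 0`. [folklore] -/
theorem singularAt_zero_nsRescale_of_singularAt
    {v : ℝ → EuclideanSpace ℝ (Fin 3) → EuclideanSpace ℝ (Fin 3)} (hsing : SingularAt v 0)
    {lam : ℝ} (hlam : 0 < lam) : SingularAt (nsRescale lam v) 0 := by
  intro r hr A
  obtain ⟨t, ht, y, hy, hA⟩ := hsing (lam * r) (mul_pos hlam hr) (A / lam)
  have hl2 : 0 < lam ^ 2 := pow_pos hlam 2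
  refine ⟨t / lam ^ 2, ⟨?_, div_neg_of_neg_of_pos ht.2 hl2⟩, lam⁻¹ • y, ?_, ?_⟩
  · rw [lt_div_iff₀ hl2]
    nlinarith [ht.1]
  · rw [Metric.mem_ball, dist_zero_right, norm_smul, norm_inv, Real.norm_of_nonneg hlam.le,
      inv_mul_lt_iff₀ hlam]
    rwa [Metric.mem_ball, dist_zero_right] at hy
  · rw [nsRescale_apply, mul_div_cancel₀ _ hl2.ne', smul_inv_smul₀ hlam.ne', norm_smul,
      Real.norm_of_nonneg hlam.le]
    rwa [div_lt_iff₀' hlam] at hA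

/-! ### (U4) loud at every scale, uniformly -/

/-- **(U4) MULTISCALE UNIFORM LOUDNESS, envelope class**: with `c(M)` and `s₀(M,A)` of (U2), every member
singular at the apex has, for EVERY `λ ∈ (0,1]` and every `s ∈ [λ²s₀, 0)`, a point `x ∈ B(0,λ)` with
`c/√(−s) < ‖v(s,x)‖` — apply (U2) to the zoom `λv(λ²·,λ·)`, a member with the SAME `(M, A)`
(`IsTypeIAncientMild.nsRescale`, `HasTypeIDecay.nsRescale`, (U3)), and unscale. [folklore] -/
theorem exists_levelM_multiscale_loud_of_envelope (M : ℝ) :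
    ∃ c : ℝ, 0 < c ∧ ∀ A : ℝ, ∃ s₀ : ℝ, s₀ < 0 ∧
      ∀ v : ℝ → EuclideanSpace ℝ (Fin 3) → EuclideanSpace ℝ (Fin 3),
        IsTypeIAncientMild M v → HasTypeIDecay A v → SingularAt v 0 →
        ∀ lam ∈ Set.Ioc (0 : ℝ) 1, ∀ s ∈ Set.Ico (lam ^ 2 * s₀) 0,
          ∃ x ∈ Metric.ball (0 : EuclideanSpace ℝ (Fin 3)) lam, c / Real.sqrt (-s) < ‖v s x‖ := by
  obtain ⟨c, hc, H⟩ := exists_levelM_loud_of_envelope M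
  refine ⟨c, hc, fun A => ?_⟩
  obtain ⟨s₀, hs₀, H'⟩ := H A
  refine ⟨s₀, hs₀, fun v hv hdec hsing lam hlam s hs => ?_⟩
  have hl : 0 < lam := hlam.1
  have hl2 : 0 < lam ^ 2 := pow_pos hl 2
  have hσ : s / lam ^ 2 ∈ Set.Ico s₀ 0 := by
    refine ⟨?_, div_neg_of_neg_of_pos hs.2 hl2⟩
    rw [le_div_iff₀ hl2]
    linarith [hs.1]
  obtain ⟨y, hy, hlt⟩ := H' (nsRescale lam v) (hv.nsRescale hl) (hdec.nsRescale hl)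
    (singularAt_zero_nsRescale_of_singularAt hsing hl) (s / lam ^ 2) hσ
  have hsq : Real.sqrt (-(s / lam ^ 2)) = Real.sqrt (-s) / lam := by
    rw [show -(s / lam ^ 2) = -s / lam ^ 2 by ring, Real.sqrt_div' _ hl2.le, Real.sqrt_sq hl.le]
  rw [nsRescale_apply, mul_div_cancel₀ _ hl2.ne', norm_smul, Real.norm_of_nonneg hl.le, hsq,
    div_div_eq_mul_div] at hlt
  have hpos : 0 < Real.sqrt (-s) := Real.sqrt_pos.2 (by linarith [hs.2])
  refine ⟨lam • y, ?_, ?_⟩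
  · rw [Metric.mem_ball, dist_zero_right, norm_smul, Real.norm_of_nonneg hl.le]
    rw [Metric.mem_ball, dist_zero_right] at hy
    nlinarith
  · rw [div_lt_iff₀ hpos] at hlt ⊢
    have key : lam * c < lam * (‖v s (lam • y)‖ * Real.sqrt (-s)) := by nlinarith [hlt]
    exact lt_of_mul_lt_mul_left key hl.le

/-! ### (U5) the apex singularity is closed under locally uniform limits at fixed `(M, A)` -/

/-- **(U5) CLOSEDNESS OF THE APEX SINGULARITY (envelope class)**: enveloped singular members `v n` with the SAME
`(M, A)`, converging at each fixed `s < 0` uniformly on `B(0,1)` to a field `w`, have a limit singular AT THE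
APEX: `SingularAt w 0`.  (At a late time `s` with `c/(2√(−s)) > |A₀| + 1`, (U4) at scale `λ = min 1 (r/2)`
puts a loud point of `v N` inside `B(0,λ) ⊂ B(0,r)`, and uniform closeness `≤ c/(2√(−s))` transfers half
the floor to `w`.) [folklore] -/
theorem singularAt_zero_of_limit_envelopedSingular {M A : ℝ}
    {v : ℕ → ℝ → EuclideanSpace ℝ (Fin 3) → EuclideanSpace ℝ (Fin 3)}
    {w : ℝ → EuclideanSpace ℝ (Fin 3) → EuclideanSpace ℝ (Fin 3)}
    (hv : ∀ n, IsTypeIAncientMild M (v n)) (hdec : ∀ n, HasTypeIDecay A (v n))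
    (hsing : ∀ n, SingularAt (v n) 0)
    (hconv : ∀ s < 0, ∀ ε > 0, ∃ N : ℕ, ∀ n ≥ N,
      ∀ x ∈ Metric.ball (0 : EuclideanSpace ℝ (Fin 3)) 1, ‖v n s x - w s x‖ ≤ ε) :
    SingularAt w 0 := by
  obtain ⟨c, hc, H⟩ := exists_levelM_multiscale_loud_of_envelope M
  obtain ⟨s₀, hs₀, H'⟩ := H A
  intro r hr A₀
  -- the scale
  set lam : ℝ := min 1 (r / 2) with hlam_def
  have hlam : lam ∈ Set.Ioc (0 : ℝ) 1 := ⟨lt_min one_pos (by linarith), min_le_left _ _⟩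
  have hlamr : lam < r := lt_of_le_of_lt (min_le_right _ _) (by linarith)
  have hl2s₀ : lam ^ 2 * s₀ < 0 := mul_neg_of_pos_of_neg (pow_pos hlam.1 2) hs₀
  -- the time
  set a : ℝ := c / (2 * (|A₀| + 1)) with ha
  have ha0 : 0 < a := by positivity
  set m : ℝ := min (r ^ 2) (min (-(lam ^ 2 * s₀)) (a ^ 2)) with hm
  have hm0 : 0 < m := lt_min (by positivity) (lt_min (by linarith) (by positivity))
  have hm1 : m ≤ r ^ 2 := min_le_left _ _
  have hm2 : m ≤ -(lam ^ 2 * s₀) := (min_le_right _ _).trans (min_le_left _ _)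
  have hm3 : m ≤ a ^ 2 := (min_le_right _ _).trans (min_le_right _ _)
  set s : ℝ := -(m / 2) with hs_def
  have hs_neg : s < 0 := by rw [hs_def]; linarith
  have hs_Ico : s ∈ Set.Ico (lam ^ 2 * s₀) 0 := ⟨by rw [hs_def]; linarith, hs_neg⟩
  have hs_r : s ∈ Set.Ioo (-(r ^ 2)) 0 := ⟨by rw [hs_def]; linarith, hs_neg⟩
  have hsq_pos : 0 < Real.sqrt (-s) := Real.sqrt_pos.2 (by linarith)
  have hsq_lt : Real.sqrt (-s) < a := by
    rw [Real.sqrt_lt' ha0, hs_def]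
    linarith
  -- the witness
  obtain ⟨N, hN⟩ := hconv s hs_neg (c / (2 * Real.sqrt (-s))) (by positivity)
  obtain ⟨x, hx, hlt⟩ := H' (v N) (hv N) (hdec N) (hsing N) lam hlam s hs_Ico
  have hx1 : x ∈ Metric.ball (0 : EuclideanSpace ℝ (Fin 3)) 1 := Metric.ball_subset_ball hlam.2 hx
  have hxr : x ∈ Metric.ball (0 : EuclideanSpace ℝ (Fin 3)) r := Metric.ball_subset_ball hlamr.le hx
  refine ⟨s, hs_r, x, hxr, ?_⟩
  have h1 : ‖v N s x‖ ≤ ‖w s x‖ + c / (2 * Real.sqrt (-s)) := by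
    have hclose := hN N le_rfl x hx1
    calc ‖v N s x‖ = ‖(v N s x - w s x) + w s x‖ := by rw [sub_add_cancel]
      _ ≤ ‖v N s x - w s x‖ + ‖w s x‖ := norm_add_le _ _
      _ ≤ ‖w s x‖ + c / (2 * Real.sqrt (-s)) := by linarith
  have hne : Real.sqrt (-s) ≠ 0 := hsq_pos.ne'
  have e : c / Real.sqrt (-s) = 2 * (c / (2 * Real.sqrt (-s))) := by
    field_simp
  have h2 : c / (2 * Real.sqrt (-s)) < ‖w s x‖ := by linarith [hlt, h1]
  have h3 : |A₀| + 1 < c / (2 * Real.sqrt (-s)) := by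
    rw [lt_div_iff₀ (by positivity)]
    rw [ha] at hsq_lt
    have h4 := (lt_div_iff₀ (by positivity : (0 : ℝ) < 2 * (|A₀| + 1))).1 hsq_lt
    linarith
  linarith [le_abs_self A₀]

end Summit.NavierStokesRegularity.NavierStokesRegularity.Theorems.TypeIQuantSubcubicExp.Negative
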